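import Summits.MatrixMultiplication.MatrixMultiplication.Theorems.SoloInformedTwistedMatchingsEffectiveTable
import Summits.MatrixMultiplication.MatrixMultiplication.Theorems.SoloInformedTwistedMatchingsPGroupPCGS
import HarnessLib

/-!
# Theorem B″ for NON-ABELIAN hosts: finite `p`-groups of bounded class and exponent

Solo-informed seat (MatrixMultiplication), gen 102; sharpest-statement §2y(8). Cohn–Umans 2013 §6.3
advertise GROUP ASSOCIATION SCHEMES — the Schurian scheme of `G × G` acting on `G` by `x g y⁻¹`,
commutative for every finite group `G`, classes = conjugacy classes — as a family that "suffices to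
prove nontrivial bounds on `ω`". In the language of this series a group association scheme is the
translation scheme `𝒮(G, Inn G)`, and its triangles are the twisted triangle predicate
`g · φ(h) · ψ(l) = 1`, `(φ, ψ) ∈ (Inn G)²`. The BCCGU nilpotent barrier survives such twisting:

* `twistedMatching_card_le_effective_pGroup` — PARAMETRIC EFFECTIVE BOUND: `S` a finite `p`-group of
  nilpotency class `≤ c` and exponent dividing `p^e`; if `0 < u ≤ 1` and every level `s < c·e`
  satisfies `u^{-(p-1)(p+1)^s/3} Σ_{j<p} u^{j(p+1)^s} ≤ p^r`, then every twisted matching in `S` under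
  ANY finite family of automorphism-pair twists has `|ι| ≤ 3 |S|^r` (the level-respect hypothesis of
  `card_le_of_levelTwistedMatching` holds for every endomorphism by `exists_levelPCGS_of_pGroup`).
* `exists_pGroupTwistedMatching_card_le` — the ineffective form: `δ = δ(p, c, e) > 0` with
  `|ι| ≤ 3 |S|^{1-δ}`.
* `twistedMatching_card_le_exp_three_class_two` — exponent `3`, class `≤ 2` (Heisenberg groups over
  `𝔽₃`, extraspecial `3^{1+2n}` of exponent `3`, …): `|ι| ≤ 3 |S|^{24/25}` (`u = 4/5`).
The D13 headlines (group association schemes force large hosts) are in `SoloInformedGroupSchemes`.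
References: CohnUmans2013 (arXiv:1207.6528) §6.3, Def. 11/12; BlasiakChurchCohnGrochowUmans2017
(arXiv:1712.02302) Def. 3.5, Prop. 3.10, Thm. 3.11, Cor. 3.20; BCCGNSU17 (arXiv:1605.06702) §4.
-/

noncomputable section

open scoped BigOperators
open Finset Literature.Combinatorics.Additive Literature.Barriers.MatrixMultiplication

namespace Summit.MatrixMultiplication.MatrixMultiplication.Theorems.TwistedSliceRank

section PGroup

/-- **Parametric effective B″ for finite `p`-groups of class `≤ c` and exponent dividing `p^e`.**
If `0 < u ≤ 1` and every level `s < c·e` satisfies `u^{-(p-1)(p+1)^s/3} Σ_{j<p} u^{j(p+1)^s} ≤ p^r`,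
then twisted matchings in `S` have `|ι| ≤ 3 |S|^r`, whatever the automorphism-pair twists.
[this work] -/
theorem twistedMatching_card_le_effective_pGroup (p : ℕ) [hp : Fact p.Prime] (c e : ℕ) (he : 0 < e)
    (u r : ℝ) (hu0 : 0 < u) (hu1 : u ≤ 1)
    (hθ : ∀ s : ℕ, s < c * e →
      u ^ (-(((p - 1 : ℕ) : ℝ)) * ((p : ℝ) + 1) ^ s / 3) *
        ∑ j : Fin p, u ^ (((j : ℕ) : ℝ) * ((p : ℝ) + 1) ^ s) ≤ (p : ℝ) ^ r)
    (S : Type) [Group S] [Fintype S] [DecidableEq S] [Group.IsNilpotent S]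
    (hc : Group.nilpotencyClass S ≤ c) (hexp : Monoid.exponent S ∣ p ^ e)
    (σ : Type) [Fintype σ] (φ ψ : σ → S ≃* S) (ι : Type) [Fintype ι] (x y z : ι → S)
    (hmatch : ∀ i j l : ι, (∃ s : σ, x i * φ s (y j) * ψ s (z l) = 1) ↔ (i = j ∧ j = l)) :
    (Fintype.card ι : ℝ) ≤ 3 * (Fintype.card S : ℝ) ^ r := by
  classical
  have hp2 : 2 ≤ p := hp.out.two_le
  have hp0 : (0 : ℝ) < p := by exact_mod_cast hp.out.pos
  obtain ⟨ιA, _, _, C, hCL, hS'⟩ := exists_levelPCGS_of_pGroup (p := p) (S := S) he hc hexp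
  -- the field and the weights
  have hinj : Function.Injective
      (algebraMap (Polynomial (ZMod p)) (FractionRing (Polynomial (ZMod p)))) :=
    IsFractionRing.injective (Polynomial (ZMod p)) (FractionRing (Polynomial (ZMod p)))
  haveI : CharP (FractionRing (Polynomial (ZMod p))) p := charP_of_injective_algebraMap hinj p
  haveI : Infinite (FractionRing (Polynomial (ZMod p))) := Infinite.of_injective _ hinj
  let Sol : ι → Finset σ := fun i => Finset.univ.filter fun s => x i * φ s (y i) * ψ s (z i) = 1
  have hSol : ∀ i, (Sol i).Nonempty := fun i => by
    obtain ⟨s, hs⟩ := (hmatch i i i).2 ⟨rfl, rfl⟩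
    exact ⟨s, by simp [Sol, hs]⟩
  obtain ⟨t, ht⟩ := exists_weights (K := FractionRing (Polynomial (ZMod p))) Sol hSol
  have hdiag : ∀ i, (∑ s, t s * (if x i * φ s (y i) * ψ s (z i) = 1
      then (1 : FractionRing (Polynomial (ZMod p))) else 0)) ≠ 0 := by
    intro i
    have hsum : (∑ s, t s * (if x i * φ s (y i) * ψ s (z i) = 1
        then (1 : FractionRing (Polynomial (ZMod p))) else 0)) = ∑ s ∈ Sol i, t s := by
      rw [Finset.sum_filter]
      exact Finset.sum_congr rfl fun s _ => by split_ifs <;> simp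
    rw [hsum]
    exact ht i
  -- total weight `D = (p-1) Σ_a W_a`, threshold `tt = ⌈D/3⌉`
  set D : ℕ := (p - 1) * ∑ a, C.W a with hD
  set tt : ℕ := (D + 2) / 3 with htt
  have hcard := card_le_of_levelTwistedMatching C (K := FractionRing (Polynomial (ZMod p))) hS' t
    φ ψ x y z (fun i j l s h => (hmatch i j l).1 ⟨s, h⟩) hdiag tt tt
  have hcard' : (Fintype.card ι : ℝ) ≤
      (Fintype.card {ex : ιA → Fin p // ∑ a, (ex a : ℕ) * C.W a < tt} : ℝ) +
      (Fintype.card {ex : ιA → Fin p // ∑ a, (ex a : ℕ) * C.W a < tt} : ℝ) +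
      (Fintype.card {ex : ιA → Fin p // tt + tt ≤ ∑ a, (ex a : ℕ) * C.W a} : ℝ) := by
    exact_mod_cast hcard
  have hdegle : ∀ ex : ιA → Fin p, ∑ a, (ex a : ℕ) * C.W a ≤ D := by
    intro ex
    rw [hD, Finset.mul_sum]
    exact Finset.sum_le_sum fun a _ => Nat.mul_le_mul_right _ (by have := (ex a).2; omega)
  -- the weights as reals
  let Wr : ιA → ℝ := fun a => ((C.W a : ℕ) : ℝ)
  have hWr : ∀ a, Wr a = ((p : ℝ) + 1) ^ C.lvl a := by
    intro a
    show (((p + 1) ^ C.lvl a : ℕ) : ℝ) = _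
    push_cast; ring
  have hDr : (D : ℝ) = ((p - 1 : ℕ) : ℝ) * ∑ a, Wr a := by
    rw [hD]; push_cast; rfl
  -- the per-coordinate factor and its bound
  let F : ιA → ℝ := fun a =>
    u ^ (-(((p - 1 : ℕ) : ℝ)) * Wr a / 3) * ∑ j : Fin p, u ^ (((j : ℕ) : ℝ) * Wr a)
  have hF : ∀ a, F a ≤ (p : ℝ) ^ r := by
    intro a
    have h1 := hθ (C.lvl a) (by rw [← hCL]; exact C.lvl_lt a)
    simp only [F, hWr]
    exact h1
  have hF0 : ∀ a, 0 ≤ F a := fun a =>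
    mul_nonneg (Real.rpow_nonneg hu0.le _) (Finset.sum_nonneg fun j _ => Real.rpow_nonneg hu0.le _)
  have hS : (Fintype.card S : ℝ) = (p : ℝ) ^ Fintype.card ιA := by
    rw [← Nat.card_eq_fintype_card, C.card_eq]; push_cast; rfl
  have hprod : ∏ a, F a ≤ (Fintype.card S : ℝ) ^ r := by
    calc ∏ a, F a ≤ ∏ _a : ιA, (p : ℝ) ^ r :=
          Finset.prod_le_prod (fun a _ => hF0 a) fun a _ => hF a
      _ = (Fintype.card S : ℝ) ^ r := by
          rw [Finset.prod_const, Finset.card_univ, hS, ← Real.rpow_natCast ((p : ℝ) ^ r),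
            ← Real.rpow_mul hp0.le, mul_comm, Real.rpow_mul hp0.le, Real.rpow_natCast]
  have hprodF : ∏ a, F a = u ^ (-((D : ℝ) / 3)) * ∏ a, ∑ j : Fin p, u ^ (((j : ℕ) : ℝ) * Wr a) := by
    simp only [F]
    rw [Finset.prod_mul_distrib, ← Real.rpow_sum_of_pos hu0]
    congr 2
    rw [hDr, Finset.mul_sum, Finset.sum_div, ← Finset.sum_neg_distrib]
    refine Finset.sum_congr rfl fun a _ => by ring
  -- lower tail
  have hlow : (Fintype.card {ex : ιA → Fin p // ∑ a, (ex a : ℕ) * C.W a < tt} : ℝ) ≤ ∏ a, F a := by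
    have h1 := card_subtype_le_sum_rpow (fun ex : ιA → Fin p => ∑ a, (ex a : ℕ) * C.W a < tt)
      u hu0 (fun ex => -((D : ℝ) / 3) + 1 * ∑ a, ((ex a : ℕ) : ℝ) * Wr a) (fun ex hex => by
        refine Real.one_le_rpow_of_pos_of_le_one_of_nonpos hu0 hu1 ?_
        have h3 : 3 * ∑ a, (ex a : ℕ) * C.W a ≤ D := by omega
        have h4 : (3 : ℝ) * ∑ a, ((ex a : ℕ) : ℝ) * Wr a ≤ D := by
          show (3 : ℝ) * ∑ a, ((ex a : ℕ) : ℝ) * ((C.W a : ℕ) : ℝ) ≤ D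
          exact_mod_cast h3
        linarith)
    refine h1.trans (le_of_eq ?_)
    rw [sum_rpow_weighted p u hu0, hprodF]
    simp only [one_mul]
  -- upper tail
  have hhigh : (Fintype.card {ex : ιA → Fin p // tt + tt ≤ ∑ a, (ex a : ℕ) * C.W a} : ℝ) ≤
      ∏ a, F a := by
    have h1 := card_subtype_le_sum_rpow
      (fun ex : ιA → Fin p => tt + tt ≤ ∑ a, (ex a : ℕ) * C.W a)
      u hu0 (fun ex => 2 * (D : ℝ) / 3 + (-1) * ∑ a, ((ex a : ℕ) : ℝ) * Wr a) (fun ex hex => by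
        refine Real.one_le_rpow_of_pos_of_le_one_of_nonpos hu0 hu1 ?_
        have h3 : 2 * D ≤ 3 * ∑ a, (ex a : ℕ) * C.W a := by omega
        have h4 : (2 : ℝ) * D ≤ 3 * ∑ a, ((ex a : ℕ) : ℝ) * Wr a := by
          show (2 : ℝ) * D ≤ 3 * ∑ a, ((ex a : ℕ) : ℝ) * ((C.W a : ℕ) : ℝ)
          exact_mod_cast h3
        linarith)
    refine h1.trans (le_of_eq ?_)
    rw [sum_rpow_weighted p u hu0]
    have h2 : ∀ a, ∑ j : Fin p, u ^ (-1 * ((j : ℕ) : ℝ) * Wr a) =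
        u ^ (-(((p - 1 : ℕ) : ℝ)) * Wr a) * ∑ j : Fin p, u ^ (((j : ℕ) : ℝ) * Wr a) :=
      fun a => sum_rpow_neg_weighted p u hu0 (Wr a)
    simp_rw [h2]
    rw [Finset.prod_mul_distrib, ← Real.rpow_sum_of_pos hu0, ← mul_assoc, ← Real.rpow_add hu0,
      hprodF]
    congr 2
    rw [hDr, Finset.mul_sum, Finset.sum_div, Finset.mul_sum, Finset.sum_div,
      ← Finset.sum_add_distrib, ← Finset.sum_neg_distrib]
    refine Finset.sum_congr rfl fun a _ => by ring
  calc (Fintype.card ι : ℝ) ≤ _ := hcard'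
    _ ≤ (∏ a, F a) + (∏ a, F a) + ∏ a, F a := by gcongr
    _ = 3 * ∏ a, F a := by ring
    _ ≤ 3 * (Fintype.card S : ℝ) ^ r := by linarith [hprod]

/-- **Twisted matchings in finite `p`-groups of bounded class and exponent are polynomially small**
(ineffective form): for every prime `p` and all `c`, `e ≥ 1` there is `δ > 0` such that every twisted
matching in a finite `p`-group of class `≤ c` and exponent dividing `p^e`, under any finite family of
automorphism-pair twists, has `|ι| ≤ 3 |S|^{1-δ}`. [this work] -/
theorem exists_pGroupTwistedMatching_card_le (p : ℕ) [hp : Fact p.Prime] (c e : ℕ) (he : 0 < e) :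
    ∃ δ : ℝ, 0 < δ ∧ ∀ (S : Type) [Group S] [Fintype S] [DecidableEq S] [Group.IsNilpotent S],
      Group.nilpotencyClass S ≤ c → Monoid.exponent S ∣ p ^ e →
      ∀ (σ : Type) [Fintype σ] (φ ψ : σ → S ≃* S) (ι : Type) [Fintype ι] (x y z : ι → S),
      (∀ i j l : ι, (∃ s : σ, x i * φ s (y j) * ψ s (z l) = 1) ↔ (i = j ∧ j = l)) →
      (Fintype.card ι : ℝ) ≤ 3 * (Fintype.card S : ℝ) ^ (1 - δ) := by
  classical
  have hp2 : 2 ≤ p := hp.out.two_le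
  obtain ⟨ρ, hρ0, hρ1, hdecay⟩ :=
    exists_tail_decay hp2 (Wmax := (p + 1) ^ (c * e - 1)) (Nat.one_le_pow _ _ (Nat.succ_pos p))
  have hp1 : (1 : ℝ) < p := by exact_mod_cast hp.out.one_lt
  have hlogp : 0 < Real.log p := Real.log_pos hp1
  have hlogρ : Real.log ρ < 0 := Real.log_neg hρ0 hρ1
  set δ : ℝ := -Real.log ρ / Real.log p with hδ
  have hδ0 : 0 < δ := by rw [hδ]; exact div_pos (by linarith) hlogp
  refine ⟨δ, hδ0, ?_⟩
  intro S _ _ _ _ hc hexp σ _ φ ψ ι _ x y z hmatch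
  obtain ⟨ιA, _, _, C, hCL, hS'⟩ := exists_levelPCGS_of_pGroup (p := p) (S := S) he hc hexp
  -- the field and the weights
  have hinj : Function.Injective
      (algebraMap (Polynomial (ZMod p)) (FractionRing (Polynomial (ZMod p)))) :=
    IsFractionRing.injective (Polynomial (ZMod p)) (FractionRing (Polynomial (ZMod p)))
  haveI : CharP (FractionRing (Polynomial (ZMod p))) p := charP_of_injective_algebraMap hinj p
  haveI : Infinite (FractionRing (Polynomial (ZMod p))) := Infinite.of_injective _ hinj
  let Sol : ι → Finset σ := fun i => Finset.univ.filter fun s => x i * φ s (y i) * ψ s (z i) = 1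
  have hSol : ∀ i, (Sol i).Nonempty := fun i => by
    obtain ⟨s, hs⟩ := (hmatch i i i).2 ⟨rfl, rfl⟩
    exact ⟨s, by simp [Sol, hs]⟩
  obtain ⟨t, ht⟩ := exists_weights (K := FractionRing (Polynomial (ZMod p))) Sol hSol
  have hdiag : ∀ i, (∑ s, t s * (if x i * φ s (y i) * ψ s (z i) = 1
      then (1 : FractionRing (Polynomial (ZMod p))) else 0)) ≠ 0 := by
    intro i
    have hsum : (∑ s, t s * (if x i * φ s (y i) * ψ s (z i) = 1
        then (1 : FractionRing (Polynomial (ZMod p))) else 0)) = ∑ s ∈ Sol i, t s := by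
      rw [Finset.sum_filter]
      exact Finset.sum_congr rfl fun s _ => by split_ifs <;> simp
    rw [hsum]
    exact ht i
  -- weights are in `[1, (p+1)^{ce-1}]`
  have hW1 : ∀ a : ιA, 1 ≤ C.W a := fun a => Nat.one_le_pow _ _ (Nat.succ_pos p)
  have hW2 : ∀ a : ιA, C.W a ≤ (p + 1) ^ (c * e - 1) := by
    intro a
    show (p + 1) ^ C.lvl a ≤ (p + 1) ^ (c * e - 1)
    have h1 := C.lvl_lt a
    rw [hCL] at h1
    exact Nat.pow_le_pow_right (Nat.succ_pos p) (by omega)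
  obtain ⟨tt, hlow, hhigh⟩ := hdecay ιA C.W hW1 hW2
  have hcard := card_le_of_levelTwistedMatching C (K := FractionRing (Polynomial (ZMod p))) hS' t
    φ ψ x y z (fun i j l s h => (hmatch i j l).1 ⟨s, h⟩) hdiag tt tt
  have hcard' : (Fintype.card ι : ℝ) ≤
      (Fintype.card {ex : ιA → Fin p // ∑ a, (ex a : ℕ) * C.W a < tt} : ℝ) +
      (Fintype.card {ex : ιA → Fin p // ∑ a, (ex a : ℕ) * C.W a < tt} : ℝ) +
      (Fintype.card {ex : ιA → Fin p // tt + tt ≤ ∑ a, (ex a : ℕ) * C.W a} : ℝ) := by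
    exact_mod_cast hcard
  -- `ρ^{|ιA|} p^{|ιA|} = |S|^{1-δ}`
  have hS : (Fintype.card S : ℝ) = (p : ℝ) ^ Fintype.card ιA := by
    rw [← Nat.card_eq_fintype_card, C.card_eq]; push_cast; rfl
  have hkey : ρ ^ Fintype.card ιA * (p : ℝ) ^ Fintype.card ιA =
      (Fintype.card S : ℝ) ^ (1 - δ) := by
    rw [hS]
    have hp0 : (0 : ℝ) < p := by linarith
    have hρp : ρ = (p : ℝ) ^ (-δ) := by
      rw [Real.rpow_def_of_pos hp0, hδ]
      have : Real.log p * -(-Real.log ρ / Real.log p) = Real.log ρ := by field_simp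
      rw [this, Real.exp_log hρ0]
    rw [hρp, ← Real.rpow_natCast, ← Real.rpow_natCast, ← Real.rpow_mul hp0.le,
      ← Real.rpow_mul hp0.le, ← Real.rpow_add hp0]
    congr 1; ring
  calc (Fintype.card ι : ℝ) ≤ _ := hcard'
    _ ≤ ρ ^ Fintype.card ιA * (p : ℝ) ^ Fintype.card ιA +
        ρ ^ Fintype.card ιA * (p : ℝ) ^ Fintype.card ιA +
        ρ ^ Fintype.card ιA * (p : ℝ) ^ Fintype.card ιA := by gcongr
    _ = 3 * (Fintype.card S : ℝ) ^ (1 - δ) := by rw [← hkey]; ring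

/-- **Exponent `3`, class `≤ 2`: `|ι| ≤ 3 |S|^{24/25}`** for every twisted matching in a finite group of
exponent dividing `3` and nilpotency class `≤ 2` (Heisenberg groups `H_3(𝔽_3) ^ n × 𝔽_3^m`,
extraspecial `3`-groups of exponent `3`), under any finite family of automorphism-pair twists
(`u = 4/5`, levels `s = 0, 1` certified by `levelCond_three_two`). [this work] -/
theorem twistedMatching_card_le_exp_three_class_two (S : Type) [Group S] [Fintype S]
    [DecidableEq S] [Group.IsNilpotent S] (hc : Group.nilpotencyClass S ≤ 2)
    (hexpS : ∀ g : S, g ^ 3 = 1) (σ : Type) [Fintype σ] (φ ψ : σ → S ≃* S) (ι : Type)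
    [Fintype ι] (x y z : ι → S)
    (hmatch : ∀ i j l : ι, (∃ s : σ, x i * φ s (y j) * ψ s (z l) = 1) ↔ (i = j ∧ j = l)) :
    (Fintype.card ι : ℝ) ≤ 3 * (Fintype.card S : ℝ) ^ (24 / 25 : ℝ) := by
  haveI : Fact (Nat.Prime 3) := ⟨Nat.prime_three⟩
  refine twistedMatching_card_le_effective_pGroup 3 2 1 one_pos (4 / 5) (24 / 25) (by norm_num)
    (by norm_num) (fun s hs => levelCond_three_two s (by omega)) S hc ?_ σ φ ψ ι x y z hmatch
  rw [pow_one]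
  exact Monoid.exponent_dvd_of_forall_pow_eq_one hexpS

end PGroup

end Summit.MatrixMultiplication.MatrixMultiplication.Theorems.TwistedSliceRank
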